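import Mathlib
import Summits.ResolutionOfSingularities.ResolutionOfSingularities.Theorems.HomologicalConductorPersistenceStaircaseRecords
import HarnessLib

/-!
# Rung S-2 `PersistenceSurface` (stmt-19970), stub C1 (`Sat₄`) — the TWO-PARAMETER FAMILY `1/n(1,q)`, `q ∣ n − 1`:
# `ca(k[u,v]^{μ_n(1,q)}) = ca⁴ = ⋂_{1 ≤ d ≤ q} s̲ann(M_{−d})`, kernel-certified UNIFORMLY in `(n, q)`
# (chain W4.4b; T-V package, part 27; seat leafhand-res-homologicalconduct-10 gen 2)

[OURS · L1 w44b · rung S-2] Nothing here is a statement of the manuscript under review (Hironaka 2017);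
AI-written, weaker than expert review.

Parts 23 (`1/n(1,1)`, Veronese), 25 (`1/n(1,2)`, `n` odd) and the Gorenstein `A_{n−1} = 1/n(1,n−1)` are the three
edges of ONE family: the cyclic quotient surface singularities `U = k[u,v]^{μ_n(1,q)}` with `n = bq + 1` (`b, q ≥ 1`;
`ζ` a primitive `n`-th root of unity, `n ∈ kˣ`), i.e. `n/q = [b + 1, 2, 2, …, 2]` (`q − 1` twos), `e = q`,
`i`-series `(q, q − 1, …, 2, 1)`.  This file runs the gen-6 pipeline (isotypic splitting → record staircases →
Ω-stable distinguished family → `…CyclicQuotientIsotypic.cohomologyAnnihilator_eq_four_of_isotypicData`) on the whole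
family at once.  For a class `a` with `a.val = α = qA + ρ` (`0 ≤ ρ < q`) the orbit `j ↦ α − qj (mod n)` has the
PARAMETRIC record staircase

* `u^{α − qs} v^{s}` for `s ≤ A` (drops `q`, drop class `−q`), and — when `ρ > 0` — one more generator
  `v^{A + (q − ρ) b + 1}` (from `u^{ρ} v^{A}` the orbit climbs through `ρ + 1, …, q` before reaching `0`: one drop `ρ`,
  drop class `−ρ`); so `Ω M_a ≅ M_{−q}^{A} ⊕ M_{−ρ}^{[ρ > 0]}`;
* the family `{M_{−1}, …, M_{−q}}` is Ω-stable: `M_{−q} | Ω M_{−1}` (`α = bq`, position `0`) and, for `1 ≤ ρ < q`,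
  `M_{−ρ} | Ω M_{−(q+1−ρ)}` (`α = (b−1)q + ρ`, position `b − 1`);
* **`cohomologyAnnihilator_one_mod_q`** — for every `q ≥ 1`, `b ≥ 1`, `n = bq + 1`: `ca(U) = ca⁴(U)` and
  `x ∈ ca(U) ↔ x ∈ ⋂_{t < q} s̲ann(M_{−(t+1)})`.

`U` is Gorenstein exactly when `q = n − 1` (`b = 1`); all other members are non-Gorenstein rational stages of the
`Sat₄` residual (`SaturationFourSurfaceResidual₄`, class (iii) of the hand censuses).  The only non-linear arithmetic
is the product `q·s`; it is isolated in the ring identities `mul_stair_identity`, `cover_identity_zero`,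
`cover_identity_pos` and everything else is `omega`.

References: folklore (Auslander 1986 / Herzog 1978 mechanism; Wunram 1988, Riemenschneider 1974 for the classical
names); res-L1-w44b-idea-1 SC-TORIC v2 (OURS, memo).
-/

-- single-problem summit: the doubled namespace component `ResolutionOfSingularities` is forced
set_option linter.dupNamespace false

noncomputable section

open CategoryTheory Literature.RingTheory.CohomologyAnnihilator MvPolynomial
open Summit.ResolutionOfSingularities.ResolutionOfSingularities.Theorems.NoZeno.SandwichCluster
open Summit.ResolutionOfSingularities.ResolutionOfSingularities.Theorems.HomologicalConductor.PersistenceAddCoverFamily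
open Summit.ResolutionOfSingularities.ResolutionOfSingularities.Theorems.HomologicalConductor.PersistenceCyclicQuotientIsotypic
open Summit.ResolutionOfSingularities.ResolutionOfSingularities.Theorems.HomologicalConductor.PersistenceCyclicQuotientIsotypicPieces
open Summit.ResolutionOfSingularities.ResolutionOfSingularities.Theorems.HomologicalConductor.PersistenceStaircaseRecords

universe u

namespace Summit.ResolutionOfSingularities.ResolutionOfSingularities.Theorems.HomologicalConductor.PersistenceCyclicQuotientOneModQ

/-! ## Arithmetic: casts into `ZMod n` and the three ring identities -/

/-- `(a.val + w n : ZMod n) = a`. [folklore] -/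
theorem natCast_val_add_mul_self {n : ℕ} [NeZero n] (a : ZMod n) (w : ℕ) :
    ((a.val + w * n : ℕ) : ZMod n) = a := by
  rw [Nat.cast_add, Nat.cast_mul, ZMod.natCast_self, mul_zero, add_zero, ZMod.natCast_zmod_val]

/-- The value of `a − y` from a certificate `v + y = a.val + w n`, `v < n`. [folklore] -/
theorem val_sub_natCast_eq {n : ℕ} [NeZero n] (a : ZMod n) {v y w : ℕ} (hv : v < n)
    (h : v + y = a.val + w * n) : (a - ((y : ℕ) : ZMod n)).val = v := by
  have h' := congrArg (Nat.cast : ℕ → ZMod n) h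
  rw [Nat.cast_add, natCast_val_add_mul_self] at h'
  rw [show a - ((y : ℕ) : ZMod n) = ((v : ℕ) : ZMod n) by rw [← h']; ring, ZMod.val_natCast_of_lt hv]

/-- `−x = n − x` in `ZMod n` for `x ≤ n`. [folklore] -/
theorem neg_natCast_eq {n : ℕ} (x : ℕ) (hx : x ≤ n) : -((x : ℕ) : ZMod n) = ((n - x : ℕ) : ZMod n) := by
  rw [Nat.cast_sub hx, ZMod.natCast_self, zero_sub]

/-- `(−x).val = n − x` for `0 < x ≤ n`. [folklore] -/
theorem val_neg_natCast {n : ℕ} [NeZero n] {x : ℕ} (hx0 : 0 < x) (hx : x ≤ n) :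
    (-((x : ℕ) : ZMod n)).val = n - x := by
  rw [neg_natCast_eq x hx, ZMod.val_natCast_of_lt (by omega)]

/-- The closing generator: `q (A + (q − ρ) b + 1) = (qA + ρ) + (q − ρ)(bq + 1)`. [folklore] -/
theorem mul_stair_identity (q b A ρ : ℕ) (hρ : ρ ≤ q) :
    q * (A + (q - ρ) * b + 1) = q * A + ρ + (q - ρ) * (b * q + 1) := by
  zify [hρ]
  ring

/-- Cover identity, no remainder: `(ρ + k) + q (A + b k) = (qA + ρ) + k (bq + 1)`. [folklore] -/
theorem cover_identity_zero (q b A ρ k : ℕ) :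
    ρ + k + q * (A + b * k) = q * A + ρ + k * (b * q + 1) := by
  ring

/-- Cover identity with remainder `1 ≤ r ≤ b`:
`(ρ + k + 1 + q (b − r)) + q (A + (b k + r)) = (qA + ρ) + (k + 1)(bq + 1)`. [folklore] -/
theorem cover_identity_pos (q b A ρ k r : ℕ) (hr : r ≤ b) :
    ρ + k + 1 + q * (b - r) + q * (A + (b * k + r)) = q * A + ρ + (k + 1) * (b * q + 1) := by
  zify [hr]
  ring

/-! ## The certificate -/

variable {k : Type u} [Field k] {n : ℕ} [NeZero n] {ζ : k} (hζ : IsPrimitiveRoot ζ n) (hn : (n : k) ≠ 0)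
variable {q : ℕ} (U : Subalgebra k (MvPolynomial (Fin 2) k))
variable (hU : ∀ p, p ∈ U ↔ aeval (fun i : Fin 2 => C (ζ ^ (![1, q] : Fin 2 → ℕ) i) * X i) p = p)

set_option maxHeartbeats 1600000 in
set_option synthInstance.maxHeartbeats 400000 in
include hζ hn hU in
/-- **`Sat₄` and the exact centre for `k[u,v]^{μ_n(1,q)}` whenever `n = bq + 1` (`b, q ≥ 1`), kernel-certified
uniformly in `(n, q)`.**  With the weight pieces `M a = {p | σ₀ p = ζ^a p}` (`σ₀ : u ↦ ζu, v ↦ ζ^{q}v`):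
`ca(U) = ca⁴(U)` and `x ∈ ca(U) ↔ x` stably annihilates `M_{−1}, …, M_{−q}` (the duals of the specials
`M_1, …, M_q`; `i`-series `(q, …, 1)` of `n/q = [b+1, 2, …, 2]`).  Edges: `q = 1` Veronese (part 23), `q = 2` part 25,
`b = 1` the Gorenstein `A_{n−1}`.  (Budgets raised locally as in parts 21–26.) [OURS · L1 w44b] -/
theorem cohomologyAnnihilator_one_mod_q (b : ℕ) (hb : 1 ≤ b) (hq : 1 ≤ q) (hnq : n = b * q + 1) :
    ∃ M : ZMod n → Submodule U ((restrictScalarsFunctor U (MvPolynomial (Fin 2) k)).obj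
        (ModuleCat.of (MvPolynomial (Fin 2) k) (MvPolynomial (Fin 2) k))),
      (∀ (a : ZMod n) (p : MvPolynomial (Fin 2) k),
        (show ((restrictScalarsFunctor U (MvPolynomial (Fin 2) k)).obj
          (ModuleCat.of (MvPolynomial (Fin 2) k) (MvPolynomial (Fin 2) k))) from p) ∈ M a ↔
        aeval (fun i : Fin 2 => C (ζ ^ (![1, q] : Fin 2 → ℕ) i) * X i) p = C (ζ ^ a.val) * p) ∧
      cohomologyAnnihilator U = cohomologyAnnihilatorOfDegree U 4 ∧
      ∀ x : U, x ∈ cohomologyAnnihilator U ↔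
        ∀ t : Fin q, StablyAnnihilates U x
          (@ModuleCat.of U _ (M (-(((t : ℕ) + 1 : ℕ) : ZMod n))) _ (M (-(((t : ℕ) + 1 : ℕ) : ZMod n))).module) := by
  classical
  have hcop : Nat.Coprime q n := by
    rw [hnq]
    exact (Nat.coprime_mul_right_add_right q 1 b).mpr (Nat.coprime_one_right q)
  obtain ⟨M, hM, ⟨e⟩⟩ := exists_isotypic_splitting hζ hn hcop U hU
  have hqn : q < n := by nlinarith
  have hval : ∀ a : ZMod n, a.val < n := fun a => ZMod.val_lt a
  have hdm : ∀ a : ZMod n, q * (a.val / q) + a.val % q = a.val := fun a => Nat.div_add_mod _ _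
  have hml : ∀ a : ZMod n, a.val % q < q := fun a => Nat.mod_lt _ (by omega)
  -- per-class staircase data, `α = a.val = q A + ρ`
  let A : ZMod n → ℕ := fun a => a.val / q
  let ρ : ZMod n → ℕ := fun a => a.val % q
  let μ : ZMod n → ℕ := fun a => if ρ a = 0 then A a else A a + 1
  let J : ZMod n → ℕ := fun a => if ρ a = 0 then A a else A a + (q - ρ a) * b + 1
  let c : ZMod n → ℕ → ℕ := fun a s => if s ≤ A a then a.val - q * s else 0
  let j : ZMod n → ℕ → ℕ := fun a s => if s ≤ A a then s else J a
  let d : ZMod n → ℕ → ZMod n := fun a t => if t < A a then -((q : ℕ) : ZMod n) else -((ρ a : ℕ) : ZMod n)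
  have hAJ : ∀ a, A a ≤ J a := fun a => by dsimp only [J]; split_ifs <;> omega
  have hc_anti : ∀ a, Antitone (c a) := by
    intro a s t hst
    have := Nat.mul_le_mul_left q hst
    dsimp only [c]
    split_ifs <;> omega
  have hj_mono : ∀ a, Monotone (j a) := by
    intro a s t hst
    have := hAJ a
    dsimp only [j]
    split_ifs <;> omega
  -- the class of every generator
  have hcl : ∀ a s, ((c a s + q * j a s : ℕ) : ZMod n) = a := by
    intro a s
    have hA := hdm a
    dsimp only [c, j, J, A, ρ]
    by_cases hs : s ≤ a.val / q
    · have := Nat.mul_le_mul_left q hs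
      rw [if_pos hs, if_pos hs, show a.val - q * s + q * s = a.val by omega, ZMod.natCast_zmod_val]
    · rw [if_neg hs, if_neg hs]
      by_cases h0 : a.val % q = 0
      · rw [if_pos h0, show 0 + q * (a.val / q) = a.val by omega, ZMod.natCast_zmod_val]
      · rw [if_neg h0, zero_add, mul_stair_identity q b (a.val / q) (a.val % q) (hml a).le, hA, ← hnq,
          natCast_val_add_mul_self]
  -- the drop classes: `−q` below `A`, then `−ρ` (when `ρ > 0`)
  have hψ : ∀ a t, t < μ a → d a t = a - ((c a t + q * j a (t + 1) : ℕ) : ZMod n) := by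
    intro a t ht
    have hA := hdm a
    dsimp only [μ, A, ρ] at ht
    dsimp only [d, c, j, J, A, ρ]
    by_cases htA : t < a.val / q
    · have := Nat.mul_le_mul_left q (le_of_lt htA)
      rw [if_pos htA, if_pos (le_of_lt htA), if_pos (Nat.succ_le_of_lt htA),
        show a.val - q * t + q * (t + 1) = a.val + q by rw [Nat.mul_succ]; omega, Nat.cast_add,
        ZMod.natCast_zmod_val]
      ring
    · have h0 : ¬ a.val % q = 0 := by intro h0; rw [if_pos h0] at ht; exact htA ht
      rw [if_neg h0] at ht
      have htA' : t = a.val / q := by omega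
      rw [if_neg htA, if_pos (le_of_eq htA'), if_neg (by omega), if_neg h0, htA',
        show a.val - q * (a.val / q) = a.val % q by omega,
        mul_stair_identity q b (a.val / q) (a.val % q) (hml a).le, hA, ← hnq,
        show a.val % q + (a.val + (q - a.val % q) * n) = a.val % q + a.val + (q - a.val % q) * n by ring,
        Nat.cast_add, Nat.cast_add, Nat.cast_mul, ZMod.natCast_self, mul_zero, add_zero, ZMod.natCast_zmod_val]
      ring
  -- `q J ≡ a`
  have hJ : ∀ a, ((q * J a : ℕ) : ZMod n) = a := by
    intro a
    have hA := hdm a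
    dsimp only [J, A, ρ]
    by_cases h0 : a.val % q = 0
    · rw [if_pos h0, show q * (a.val / q) = a.val by omega, ZMod.natCast_zmod_val]
    · rw [if_neg h0, mul_stair_identity q b (a.val / q) (a.val % q) (hml a).le, hA, ← hnq,
        natCast_val_add_mul_self]
  -- the cover property of the staircase on `[0, J]`
  have hcov : ∀ a i, i ≤ J a → ∃ s, s ≤ μ a ∧ j a s ≤ i ∧ c a s ≤ ((a - ((q * i : ℕ) : ZMod n) : ZMod n)).val := by
    intro a i hi
    have hA := hdm a
    have hρq := hml a
    have hlt := hval a
    dsimp only [J, μ, c, j, A, ρ] at hi ⊢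
    by_cases hiA : i ≤ a.val / q
    · have := Nat.mul_le_mul_left q hiA
      refine ⟨i, by split_ifs <;> omega, ?_, ?_⟩
      · rw [if_pos hiA]
      · rw [if_pos hiA, val_sub_natCast_eq a (v := a.val - q * i) (w := 0) (by omega) (by omega)]
    · have h0 : ¬ a.val % q = 0 := by
        intro h0
        rw [if_pos h0] at hi
        exact hiA hi
      rw [if_neg h0] at hi
      simp only [if_neg h0]
      by_cases hiJ : i < a.val / q + (q - a.val % q) * b + 1
      · -- `A < i < J`: the orbit value is `≥ ρ + 1`, so the generator `u^ρ v^A` covers `i`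
        refine ⟨a.val / q, by omega, ?_, ?_⟩
        · rw [if_pos le_rfl]; omega
        · rw [if_pos le_rfl, show a.val - q * (a.val / q) = a.val % q by omega]
          obtain ⟨m, hm⟩ := Nat.exists_eq_add_of_lt (lt_of_not_ge hiA)
          -- `i = A + m + 1`; write `m + 1 = b κ + r`
          obtain ⟨κ, r, hκr, hrb⟩ : ∃ κ r : ℕ, b * κ + r = m + 1 ∧ r < b :=
            ⟨(m + 1) / b, (m + 1) % b, Nat.div_add_mod _ _, Nat.mod_lt _ (by omega)⟩
          have hm1 : m + 1 ≤ (q - a.val % q) * b := by omega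
          by_cases hr0 : r = 0
          · -- value `ρ + κ`
            have hκ1 : κ ≤ q - a.val % q := by
              by_contra hlt'
              have h' := Nat.mul_le_mul_left b (show q - a.val % q + 1 ≤ κ by omega)
              have e1 : b * (q - a.val % q + 1) = (q - a.val % q) * b + b := by ring
              omega
            have hid := cover_identity_zero q b (a.val / q) (a.val % q) κ
            rw [hA, ← hnq] at hid
            rw [val_sub_natCast_eq a (v := a.val % q + κ) (w := κ) (by omega)
              (by rw [hm, show a.val / q + m + 1 = a.val / q + b * κ by omega]; exact hid)]
            omega
          · -- value `ρ + κ + 1 + q (b − r)`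
            have hκ1 : κ < q - a.val % q := by
              by_contra hlt'
              have h' := Nat.mul_le_mul_left b (show q - a.val % q ≤ κ by omega)
              have e1 : b * (q - a.val % q) = (q - a.val % q) * b := Nat.mul_comm _ _
              omega
            have hid := cover_identity_pos q b (a.val / q) (a.val % q) κ r hrb.le
            rw [hA, ← hnq] at hid
            have hqr : q ≤ q * r := Nat.le_mul_of_pos_right q (by omega)
            have hbr : q * (b - r) + q * r = b * q := by
              rw [← Nat.mul_add, Nat.sub_add_cancel hrb.le, Nat.mul_comm]
            rw [val_sub_natCast_eq a (v := a.val % q + κ + 1 + q * (b - r)) (w := κ + 1) (by omega)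
              (by rw [hm, show a.val / q + m + 1 = a.val / q + (b * κ + r) by omega]; exact hid)]
            omega
      · refine ⟨a.val / q + 1, le_rfl, ?_, ?_⟩
        · rw [if_neg (by omega)]; omega
        · rw [if_neg (by omega)]; exact Nat.zero_le _
  -- the staircase resolutions `Ω M_a ≅ Π_{t < μ a} M (d a t)`
  let M' : ZMod n → ModuleCat.{u} U := fun a => @ModuleCat.of U _ (M a) _ (M a).module
  let K : ZMod n → ModuleCat.{u} U := fun a => ModuleCat.of U (Π t : Fin (μ a), M (d a t))
  have hK : ∀ a, IsSyzygy 1 (M' a) (K a) := by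
    intro a
    refine isSyzygy_one_staircase_of_lt hζ U hU M hM a (μ a) (c a) (j a) (hc_anti a) (hj_mono a) (hcl a)
      (d a) (hψ a) ?_
    exact isotypic_le_span_of_cover hζ U hU M hM a (μ a) (J a) (c a) (j a) (hcl a) (hJ a) (hcov a)
  -- the certificate data: distinguished family `{M_{−1}, …, M_{−q}}`
  let ψ' : Fin q → ZMod n := fun t => -(((t : ℕ) + 1 : ℕ) : ZMod n)
  have hdψ : ∀ a t, t < μ a → ∃ s : Fin q, d a t = ψ' s := by
    intro a t ht
    dsimp only [μ, A, ρ] at ht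
    dsimp only [d, A, ρ, ψ']
    by_cases htA : t < a.val / q
    · refine ⟨⟨q - 1, by omega⟩, ?_⟩
      rw [if_pos htA, show q - 1 + 1 = q by omega]
    · have h0 : ¬ a.val % q = 0 := by intro h0; rw [if_pos h0] at ht; exact htA ht
      refine ⟨⟨a.val % q - 1, by have := hml a; omega⟩, ?_⟩
      rw [if_neg htA, show a.val % q - 1 + 1 = a.val % q by omega]
  have hfin : ∀ t, Module.Finite U (M' (ψ' t)) := fun t => finite_isotypic hζ q U hU M hM _
  have hKD : ∀ a, IsRetractOfPower (ModuleCat.of U ((Π t, M' (ψ' t)) × U)) (K a) := by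
    intro a
    refine IsRetractOfPower.piFamily (fun t : Fin (μ a) => M' (d a t)) fun t => ?_
    obtain ⟨s, heq⟩ := hdψ a t t.isLt
    exact (isRetractOfPower_fst (ModuleCat.of U (Π t, M' (ψ' t))) (ModuleCat.of U U)).of_isRetractOfPower_gen
      ((isRetractOfPower_eval (fun t : Fin q => M' (ψ' t)) s).of_iso
        (LinearEquiv.toModuleIso (LinearEquiv.ofEq _ _ (by rw [heq]))))
  have hD : ∀ t, ∃ (s : Fin q) (i : M' (ψ' t) ⟶ K (ψ' s)) (r : K (ψ' s) ⟶ M' (ψ' t)),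
      i ≫ r = 𝟙 (M' (ψ' t)) := by
    -- `M_{−q} | Ω M_{−1}` at position `0`; `M_{−ρ} | Ω M_{−(q+1−ρ)}` at position `b − 1` (`1 ≤ ρ < q`)
    have hsrc : ∀ t : Fin q, ∃ (s : Fin q) (p : Fin (μ (ψ' s))), d (ψ' s) p = ψ' t := by
      intro t
      have ht := t.isLt
      by_cases htq : (t : ℕ) + 1 = q
      · -- the source `−1`: `α = n − 1 = bq`, `A = b`, `ρ = 0`
        let s : Fin q := ⟨0, by omega⟩
        have hsval : (ψ' s).val = n - 1 := val_neg_natCast (by norm_num) (by omega)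
        have hAρ : A (ψ' s) = b ∧ ρ (ψ' s) = 0 :=
          (Nat.div_mod_unique (by omega)).mpr
            ⟨by rw [hsval, hnq, Nat.add_sub_cancel, zero_add, Nat.mul_comm], by omega⟩
        have hμs : μ (ψ' s) = b := by simp only [μ, hAρ.1, hAρ.2, if_true]
        refine ⟨s, ⟨0, by rw [hμs]; omega⟩, ?_⟩
        change d (ψ' s) 0 = ψ' t
        simp only [d, hAρ.1]
        rw [if_pos (by omega)]
        change -((q : ℕ) : ZMod n) = -(((t : ℕ) + 1 : ℕ) : ZMod n)
        rw [htq]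
      · -- the source `−(q − t)`: `α = n − (q − t) = (b−1)q + (t+1)`, `A = b − 1`, `ρ = t + 1`
        let s : Fin q := ⟨q - (t : ℕ) - 1, by omega⟩
        have hsval : (ψ' s).val = n - (q - (t : ℕ)) := by
          change (-(((q - (t : ℕ) - 1 + 1 : ℕ)) : ZMod n)).val = n - (q - (t : ℕ))
          rw [show q - (t : ℕ) - 1 + 1 = q - (t : ℕ) by omega]
          exact val_neg_natCast (by omega) (by omega)
        have hAρ : A (ψ' s) = b - 1 ∧ ρ (ψ' s) = (t : ℕ) + 1 := by
          refine (Nat.div_mod_unique (by omega)).mpr ⟨?_, by omega⟩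
          rw [hsval, hnq]
          obtain ⟨b', rfl⟩ : ∃ b', b = b' + 1 := ⟨b - 1, by omega⟩
          have hcomm : q * b' = b' * q := Nat.mul_comm _ _
          rw [Nat.add_sub_cancel, Nat.add_mul, one_mul]
          omega
        have hμs : μ (ψ' s) = b := by
          simp only [μ, hAρ.1, hAρ.2, Nat.succ_ne_zero, if_false]
          omega
        refine ⟨s, ⟨b - 1, by rw [hμs]; omega⟩, ?_⟩
        change d (ψ' s) (b - 1) = ψ' t
        simp only [d, hAρ.1, hAρ.2, lt_irrefl, if_false]
        rfl
    intro t
    obtain ⟨s, p, hp⟩ := hsrc t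
    let E : M (d (ψ' s) p) ≃ₗ[U] M (ψ' t) := LinearEquiv.ofEq _ _ (by rw [hp])
    refine ⟨s,
      @ModuleCat.ofHom U _ (M (ψ' t)) (Π t' : Fin (μ (ψ' s)), M (d (ψ' s) t'))
        _ (M (ψ' t)).module _ _
        ((LinearMap.single U (fun t' : Fin (μ (ψ' s)) => M (d (ψ' s) t')) p) ∘ₗ E.symm.toLinearMap),
      @ModuleCat.ofHom U _ (Π t' : Fin (μ (ψ' s)), M (d (ψ' s) t')) (M (ψ' t))
        _ _ _ (M (ψ' t)).module (E.toLinearMap ∘ₗ LinearMap.proj p), ?_⟩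
    apply ModuleCat.hom_ext
    refine LinearMap.ext fun x => ?_
    change E ((Pi.single p (E.symm x) : Π t' : Fin (μ (ψ' s)), M (d (ψ' s) t')) p) = x
    rw [Pi.single_eq_same, LinearEquiv.apply_symm_apply]
  obtain ⟨h4, hiff⟩ := @cohomologyAnnihilator_eq_four_of_isotypicData k _ n _ ζ hζ hn q hcop U hU (Fin q) _ M' e
    K hK ψ' hfin hKD hD
  exact ⟨M, hM, h4, hiff⟩

end Summit.ResolutionOfSingularities.ResolutionOfSingularities.Theorems.HomologicalConductor.PersistenceCyclicQuotientOneModQ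

end
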